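import Summits.BirchSwinnertonDyer.BirchSwinnertonDyer.Theorems.Rank1ResidualJetPairingCounting
import HarnessLib

/-!
# T1 JET (cell `bsd-jet`), road K: the counting identity PART BY PART — subgroups split by a
# decomposition `X = X₁ ⊕ X₂`, `Y = Y₁ ⊕ Y₂` that is cross-orthogonal under a perfect pairing
# (the engine of the sign-by-sign form of Poitou–Tate counting; companion: `…PairingCountingSigns`)

HONEST FRAMING (programme file `BSD-LIT2PART-PROGRAMME-v1.md` §HONESTY, verbatim): «no tranche here
proves BSD; ARM L moves the LITERAL column of an r ≤ 1 census into the kernel-proved-modulo-named-print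
column; ARM P changes what «named print» is worth.» THEOREMS ONLY (seat `bsd-jet-pv-1`, session g3;
`--supports stmt-BirchSwinnertonDyer-14418`, helper): no definition, no named fact, no `sorry`;
PURE ALGEBRA. Nothing is booked; 0 classes move.

## Why (road K = the KERNEL discharge of the reading binders K1 ∕ K3; sheet `HOME/sheets/PV2-J6-KERNEL.md`)

Jetchev 2008 states and uses Poitou–Tate duality for Selmer structures (Thm. 5.1, p. 822) on the
`±`-EIGENSPACES of complex conjugation `τ ∈ Gal(K/ℚ)`: «exact sequences … on the `±`-eigenspaces …
the images are exact orthogonal complements with respect to `∑_v ⟨,⟩_v^±`», and the cell's abstract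
kernel Thm. 6.3 (`JET.Section6.tamagawaExponent_le_mInfty_of_minimalCoreVertex`, p471669) consumes the
COUNTING form of it on the `−ε(c)` side (`horth_q`, `horth_ℓ`). The total (both-signs) counting form is
the tree's `GlobalDuality.relIndex_selmerGroup_mul_relIndex_dualSelmerGroup` (p479216) over
`GlobalDuality.relIndex_mul_relIndex_eq_of_iInf_ker_sup` (p478877). This file is the pure-algebra
step from «total» to «part by part»: given a perfect pairing `bS : X × Y → ℤ/n` and decompositions
`X = X₁ ⊕ X₂`, `Y = Y₁ ⊕ Y₂` with `X₁ ⊥ Y₂` and `X₂ ⊥ Y₁`, the counting identity holds on the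
`(X₁, Y₁)`-parts of SPLIT subgroups. The companion file `Rank1ResidualJetPairingCountingSigns.lean`
feeds it with `X₁ = X^±`, `X₂ = X^∓` for involutions compatible with the pairing (`n` odd).

## What is proved (elementary)

* §1 split subgroups (`S ≤ (S ⊓ X₁) ⊔ (S ⊓ X₂)`): sums of split subgroups are split
  (`sup_le_inf_sup_inf_of_split`); `(A ⊔ B) ⊓ X₁ = (A ⊓ X₁) ⊔ (B ⊓ X₁)` for split `A`, `B` when
  `X₁ ⊓ X₂ = ⊥` (`sup_inf_eq_inf_sup_inf_of_split`).
* §2 cross-orthogonality: `(S ⊓ X₁)^⊥ ⊓ Y₁ = S^⊥ ⊓ Y₁` for split `S` (`iInf_ker_inf_inf_eq_of_split`);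
  the annihilator of a split subgroup is split (`iInf_ker_le_inf_sup_inf_of_split`); the pairing
  restricted to `X₁ × Y₁` (the term `(bS.comp X₁.subtype).compl₂ Y₁.subtype`, no definition) keeps
  injective adjoints (`restrict_injective`, `restrict_flip_injective`); its annihilators
  (`iInf_ker_restrict_eq`).
* §3 `relIndex_mul_relIndex_eq_of_iInf_ker_sup_of_split` — **the counting identity on the
  `(X₁, Y₁)`-parts**: for split `F ≤ G`, `L ≤ X`, `L' ≤ Y` with `(L + F)^⊥ = L' + G^⊥`,
  `F.relIndex (L ⊓ X₁) · G^⊥.relIndex (L' ⊓ Y₁) = F.relIndex (G ⊓ X₁)`.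

References (locators only; no cited FACT is declared): [cite: Jetchev2008, Thm. 5.1 and Lemma 5.2 (iii)
(p. 822), proof of Thm. 6.3 (p. 823)] [cite: MilneADT2006, Ch. I §0 (0.19)].
Design: no definitions; `Type*`-polymorphic; `AddSubgroup.relIndex` / `addSubgroupOf` transport
(`AddSubgroup.relIndex_addSubgroupOf`). Axioms: `propext`, `Classical.choice`, `Quot.sound`.
-/

set_option autoImplicit false

noncomputable section

open scoped Classical
open Function
open Literature.NumberTheory.GaloisRepresentations

namespace Summit.BirchSwinnertonDyer.Rank1Residual.JET.GlobalDuality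

/-! ### §1 Subgroups split by a decomposition `X₁ ⊕ X₂` -/

section Split

variable {X : Type*} [AddCommGroup X] (X₁ X₂ : AddSubgroup X)

/-- The sum of two split subgroups is split: if `A ≤ (A ⊓ X₁) ⊔ (A ⊓ X₂)` and likewise for `B`,
then `A ⊔ B ≤ ((A ⊔ B) ⊓ X₁) ⊔ ((A ⊔ B) ⊓ X₂)`. Elementary. -/
theorem sup_le_inf_sup_inf_of_split {A B : AddSubgroup X} (hA : A ≤ A ⊓ X₁ ⊔ A ⊓ X₂)
    (hB : B ≤ B ⊓ X₁ ⊔ B ⊓ X₂) : A ⊔ B ≤ (A ⊔ B) ⊓ X₁ ⊔ (A ⊔ B) ⊓ X₂ := by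
  refine sup_le (hA.trans ?_) (hB.trans ?_)
  · exact sup_le_sup (inf_le_inf_right _ le_sup_left) (inf_le_inf_right _ le_sup_left)
  · exact sup_le_sup (inf_le_inf_right _ le_sup_right) (inf_le_inf_right _ le_sup_right)

/-- For split subgroups `A`, `B` and `X₁ ⊓ X₂ = ⊥`: `(A ⊔ B) ⊓ X₁ = (A ⊓ X₁) ⊔ (B ⊓ X₁)` (the
`X₁`-component of a sum is the sum of the `X₁`-components). Elementary. -/
theorem sup_inf_eq_inf_sup_inf_of_split (hX : X₁ ⊓ X₂ = ⊥) {A B : AddSubgroup X}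
    (hA : A ≤ A ⊓ X₁ ⊔ A ⊓ X₂) (hB : B ≤ B ⊓ X₁ ⊔ B ⊓ X₂) :
    (A ⊔ B) ⊓ X₁ = A ⊓ X₁ ⊔ B ⊓ X₁ := by
  apply le_antisymm
  · rintro z ⟨hz, hz1⟩
    obtain ⟨a, ha, b, hb, rfl⟩ := AddSubgroup.mem_sup.mp hz
    obtain ⟨a1, ha1, a2, ha2, rfl⟩ := AddSubgroup.mem_sup.mp (hA ha)
    obtain ⟨b1, hb1, b2, hb2, rfl⟩ := AddSubgroup.mem_sup.mp (hB hb)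
    have hsum : a2 + b2 = (a1 + a2 + (b1 + b2)) - (a1 + b1) := by abel
    have h2a : a2 + b2 ∈ X₁ := by
      rw [hsum]; exact sub_mem hz1 (add_mem ha1.2 hb1.2)
    have h2 : a2 + b2 ∈ X₁ ⊓ X₂ := ⟨h2a, add_mem ha2.2 hb2.2⟩
    rw [hX, AddSubgroup.mem_bot] at h2
    have hz' : a1 + a2 + (b1 + b2) = (a1 + b1) + (a2 + b2) := by abel
    rw [hz', h2, add_zero]
    exact AddSubgroup.add_mem_sup ha1 hb1
  · exact sup_le (inf_le_inf_right _ le_sup_left) (inf_le_inf_right _ le_sup_right)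

end Split

/-! ### §2 Cross-orthogonal decompositions: annihilators of split subgroups, restricted pairings -/

section SplitPairing

variable {X Y : Type*} [AddCommGroup X] [AddCommGroup Y] {Q : Type*} [AddCommGroup Q]
  (bS : X →+ Y →+ Q) (X₁ X₂ : AddSubgroup X) (Y₁ Y₂ : AddSubgroup Y)

/-- Annihilators reverse inclusions. -/
theorem iInf_ker_anti {S S' : AddSubgroup X} (h : S ≤ S') :
    (⨅ s ∈ S', (bS s).ker : AddSubgroup Y) ≤ ⨅ s ∈ S, (bS s).ker := fun y hy =>
  (mem_iInf_ker_iff bS S y).mpr fun s hs => (mem_iInf_ker_iff bS S' y).mp hy s (h hs)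

/-- If `X₂ ⊥ Y₁` and `S` is split, an element of `Y₁` annihilates `S` as soon as it annihilates
`S ⊓ X₁`: `(S ⊓ X₁)^⊥ ⊓ Y₁ = S^⊥ ⊓ Y₁`. -/
theorem iInf_ker_inf_inf_eq_of_split (h21 : ∀ x ∈ X₂, ∀ y ∈ Y₁, bS x y = 0) {S : AddSubgroup X}
    (hS : S ≤ S ⊓ X₁ ⊔ S ⊓ X₂) :
    (⨅ s ∈ S ⊓ X₁, (bS s).ker : AddSubgroup Y) ⊓ Y₁ = (⨅ s ∈ S, (bS s).ker) ⊓ Y₁ := by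
  apply le_antisymm
  · rintro y ⟨hy, hy1⟩
    refine ⟨(mem_iInf_ker_iff bS S y).mpr fun s hs => ?_, hy1⟩
    obtain ⟨s1, hs1, s2, hs2, rfl⟩ := AddSubgroup.mem_sup.mp (hS hs)
    rw [map_add, AddMonoidHom.add_apply, (mem_iInf_ker_iff bS _ y).mp hy s1 hs1,
      h21 s2 hs2.2 y hy1, add_zero]
  · exact inf_le_inf_right _ (iInf_ker_anti bS inf_le_left)

/-- If `X₁ ⊥ Y₂`, `X₂ ⊥ Y₁`, `Y = Y₁ + Y₂` and `G` is split, then the annihilator `G^⊥` is split. -/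
theorem iInf_ker_le_inf_sup_inf_of_split (h12 : ∀ x ∈ X₁, ∀ y ∈ Y₂, bS x y = 0)
    (h21 : ∀ x ∈ X₂, ∀ y ∈ Y₁, bS x y = 0) (hY : Y₁ ⊔ Y₂ = ⊤) {G : AddSubgroup X}
    (hG : G ≤ G ⊓ X₁ ⊔ G ⊓ X₂) :
    (⨅ s ∈ G, (bS s).ker : AddSubgroup Y) ≤
      (⨅ s ∈ G, (bS s).ker) ⊓ Y₁ ⊔ (⨅ s ∈ G, (bS s).ker) ⊓ Y₂ := by
  intro y hy
  obtain ⟨y1, hy1, y2, hy2, rfl⟩ :=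
    AddSubgroup.mem_sup.mp (show y ∈ Y₁ ⊔ Y₂ from hY ▸ AddSubgroup.mem_top y)
  rw [mem_iInf_ker_iff] at hy
  refine AddSubgroup.add_mem_sup ⟨(mem_iInf_ker_iff bS G y1).mpr fun g hg => ?_, hy1⟩
    ⟨(mem_iInf_ker_iff bS G y2).mpr fun g hg => ?_, hy2⟩
  · obtain ⟨g1, hg1, g2, hg2, rfl⟩ := AddSubgroup.mem_sup.mp (hG hg)
    have e1 := hy g1 hg1.1
    rw [map_add, h12 g1 hg1.2 y2 hy2, add_zero] at e1
    rw [map_add, AddMonoidHom.add_apply, e1, h21 g2 hg2.2 y1 hy1, add_zero]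
  · obtain ⟨g1, hg1, g2, hg2, rfl⟩ := AddSubgroup.mem_sup.mp (hG hg)
    have e2 := hy g2 hg2.1
    rw [map_add, h21 g2 hg2.2 y1 hy1, zero_add] at e2
    rw [map_add, AddMonoidHom.add_apply, h12 g1 hg1.2 y2 hy2, e2, zero_add]

/-- The pairing restricted to `X₁ × Y₁`, evaluated. -/
theorem restrict_apply (x : X₁) (y : Y₁) :
    (bS.comp X₁.subtype).compl₂ Y₁.subtype x y = bS x y := rfl

/-- If `X₁ ⊥ Y₂`, `Y = Y₁ + Y₂` and the left adjoint of `bS` is injective, the left adjoint of the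
pairing restricted to `X₁ × Y₁` is injective. -/
theorem restrict_injective (h12 : ∀ x ∈ X₁, ∀ y ∈ Y₂, bS x y = 0) (hY : Y₁ ⊔ Y₂ = ⊤)
    (hl : Injective bS) : Injective ((bS.comp X₁.subtype).compl₂ Y₁.subtype) := by
  intro x x' h
  apply Subtype.ext
  apply hl
  refine AddMonoidHom.ext fun y => ?_
  obtain ⟨y1, hy1, y2, hy2, rfl⟩ :=
    AddSubgroup.mem_sup.mp (show y ∈ Y₁ ⊔ Y₂ from hY ▸ AddSubgroup.mem_top y)
  have h1 : bS x y1 = bS x' y1 := by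
    have := DFunLike.congr_fun h ⟨y1, hy1⟩
    rwa [restrict_apply, restrict_apply] at this
  rw [map_add, map_add, h1, h12 x x.2 y2 hy2, h12 x' x'.2 y2 hy2]

/-- If `X₂ ⊥ Y₁`, `X = X₁ + X₂` and the right adjoint of `bS` is injective, the right adjoint of the
pairing restricted to `X₁ × Y₁` is injective. -/
theorem restrict_flip_injective (h21 : ∀ x ∈ X₂, ∀ y ∈ Y₁, bS x y = 0) (hX : X₁ ⊔ X₂ = ⊤)
    (hr : Injective bS.flip) : Injective ((bS.comp X₁.subtype).compl₂ Y₁.subtype).flip := by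
  intro y y' h
  apply Subtype.ext
  apply hr
  refine AddMonoidHom.ext fun x => ?_
  rw [AddMonoidHom.flip_apply, AddMonoidHom.flip_apply]
  obtain ⟨x1, hx1, x2, hx2, rfl⟩ :=
    AddSubgroup.mem_sup.mp (show x ∈ X₁ ⊔ X₂ from hX ▸ AddSubgroup.mem_top x)
  have h1 : bS x1 y = bS x1 y' := by
    have := DFunLike.congr_fun h ⟨x1, hx1⟩
    rwa [AddMonoidHom.flip_apply, AddMonoidHom.flip_apply, restrict_apply, restrict_apply] at this
  rw [map_add, AddMonoidHom.add_apply, AddMonoidHom.add_apply, h1, h21 x2 hx2 y y.2,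
    h21 x2 hx2 y' y'.2]

/-- The annihilator, for the restricted pairing, of `S ∩ X₁` (viewed in `X₁`) is `(S ⊓ X₁)^⊥ ∩ Y₁`
(viewed in `Y₁`). -/
theorem iInf_ker_restrict_eq (S : AddSubgroup X) :
    (⨅ s ∈ S.addSubgroupOf X₁, (((bS.comp X₁.subtype).compl₂ Y₁.subtype) s).ker : AddSubgroup Y₁) =
      (⨅ s ∈ S ⊓ X₁, (bS s).ker : AddSubgroup Y).addSubgroupOf Y₁ := by
  ext y
  rw [mem_iInf_ker_iff, AddSubgroup.mem_addSubgroupOf, mem_iInf_ker_iff]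
  constructor
  · rintro h s ⟨hs, hs1⟩
    exact h ⟨s, hs1⟩ (AddSubgroup.mem_addSubgroupOf.mpr hs)
  · intro h s hs
    exact h s ⟨AddSubgroup.mem_addSubgroupOf.mp hs, s.2⟩

end SplitPairing

/-! ### §3 The counting identity on the `X₁ × Y₁` part -/

section SplitCounting

variable {X Y : Type*} [AddCommGroup X] [AddCommGroup Y] [Finite X] [Finite Y] {n : ℕ} [NeZero n]
  (bS : X →+ Y →+ ZMod n) (hX : ∀ x : X, n • x = 0) (hY : ∀ y : Y, n • y = 0)
  (hl : Injective bS) (hr : Injective bS.flip)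
include hX hY hl hr

/-- **The counting identity part by part.** Perfect `bS : X × Y → ℤ/n` on finite groups killed by
`n`; decompositions `X = X₁ ⊕ X₂`, `Y = Y₁ ⊕ Y₂` that are CROSS-ORTHOGONAL (`X₁ ⊥ Y₂`, `X₂ ⊥ Y₁`);
subgroups `F ≤ G` of `X`, `L ≤ X`, `L' ≤ Y`, all SPLIT by the decompositions, with
`(L + F)^⊥ = L' + G^⊥`. Then the counting identity holds on the `(X₁, Y₁)`-parts:
`F.relIndex (L ⊓ X₁) · G^⊥.relIndex (L' ⊓ Y₁) = F.relIndex (G ⊓ X₁)`, i.e.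
`[L₁ + F₁ : F₁] · [L'₁ + (G^⊥)₁ : (G^⊥)₁] = [G₁ : F₁]`. PROOF: the restricted pairing `X₁ × Y₁ → ℤ/n`
is perfect; annihilators, sums and `G^⊥` split; apply `relIndex_mul_relIndex_eq_of_iInf_ker_sup`
inside `X₁ × Y₁` and transport the indices with `AddSubgroup.relIndex_addSubgroupOf`. This is the
engine of the SIGN-BY-SIGN form of Poitou–Tate counting (Jetchev 2008 Thm. 5.1 on `±`-eigenspaces,
Lemma 5.2 (iii)): `X₁ = X^ε`, `X₂ = X^{−ε}` for an involution, see §4.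
[cite: Jetchev2008, Thm. 5.1 (p. 822), Lemma 5.2 (iii) (p. 822)] [cite: MilneADT2006, Ch. I §0 (0.19)] -/
theorem relIndex_mul_relIndex_eq_of_iInf_ker_sup_of_split (X₁ X₂ : AddSubgroup X)
    (Y₁ Y₂ : AddSubgroup Y) (hXsup : X₁ ⊔ X₂ = ⊤) (hXinf : X₁ ⊓ X₂ = ⊥) (hYsup : Y₁ ⊔ Y₂ = ⊤)
    (hYinf : Y₁ ⊓ Y₂ = ⊥) (h12 : ∀ x ∈ X₁, ∀ y ∈ Y₂, bS x y = 0)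
    (h21 : ∀ x ∈ X₂, ∀ y ∈ Y₁, bS x y = 0)
    (F G L : AddSubgroup X) (L' : AddSubgroup Y) (hFG : F ≤ G)
    (sF : F ≤ F ⊓ X₁ ⊔ F ⊓ X₂) (sG : G ≤ G ⊓ X₁ ⊔ G ⊓ X₂) (sL : L ≤ L ⊓ X₁ ⊔ L ⊓ X₂)
    (sL' : L' ≤ L' ⊓ Y₁ ⊔ L' ⊓ Y₂)
    (hann : (⨅ s ∈ L ⊔ F, (bS s).ker : AddSubgroup Y) = L' ⊔ ⨅ s ∈ G, (bS s).ker) :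
    F.relIndex (L ⊓ X₁) * (⨅ s ∈ G, (bS s).ker : AddSubgroup Y).relIndex (L' ⊓ Y₁) =
      F.relIndex (G ⊓ X₁) := by
  set annG : AddSubgroup Y := ⨅ s ∈ G, (bS s).ker with hannG
  set b₁ : X₁ →+ Y₁ →+ ZMod n := (bS.comp X₁.subtype).compl₂ Y₁.subtype with hb₁
  have hX₁ : ∀ x : X₁, n • x = 0 := fun x => Subtype.ext (by
    rw [AddSubgroupClass.coe_nsmul, hX]; rfl)
  have hY₁ : ∀ y : Y₁, n • y = 0 := fun y => Subtype.ext (by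
    rw [AddSubgroupClass.coe_nsmul, hY]; rfl)
  have hl₁ : Injective b₁ := restrict_injective bS X₁ Y₁ Y₂ h12 hYsup hl
  have hr₁ : Injective b₁.flip := restrict_flip_injective bS X₁ X₂ Y₁ h21 hXsup hr
  -- split data
  have sLF : L ⊔ F ≤ (L ⊔ F) ⊓ X₁ ⊔ (L ⊔ F) ⊓ X₂ := sup_le_inf_sup_inf_of_split X₁ X₂ sL sF
  have sAnn : annG ≤ annG ⊓ Y₁ ⊔ annG ⊓ Y₂ :=
    iInf_ker_le_inf_sup_inf_of_split bS X₁ X₂ Y₁ Y₂ h12 h21 hYsup sG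
  -- the subgroups of `X₁`, `Y₁`
  set F₁ := F.addSubgroupOf X₁ with hF₁
  set G₁ := G.addSubgroupOf X₁ with hG₁
  set L₁ := L.addSubgroupOf X₁ with hL₁
  set L'₁ := L'.addSubgroupOf Y₁ with hL'₁
  have hFG₁ : F₁ ≤ G₁ := fun x hx =>
    AddSubgroup.mem_addSubgroupOf.mpr (hFG (AddSubgroup.mem_addSubgroupOf.mp hx))
  -- annihilators for `b₁`
  have hannG₁ : (⨅ s ∈ G₁, (b₁ s).ker : AddSubgroup Y₁) = annG.addSubgroupOf Y₁ := by
    rw [hG₁, hb₁, iInf_ker_restrict_eq, ← AddSubgroup.inf_addSubgroupOf_right,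
      iInf_ker_inf_inf_eq_of_split bS X₁ X₂ Y₁ h21 sG, AddSubgroup.inf_addSubgroupOf_right]
  have hann₁ : (⨅ s ∈ L₁ ⊔ F₁, (b₁ s).ker : AddSubgroup Y₁) = L'₁ ⊔ ⨅ s ∈ G₁, (b₁ s).ker := by
    have hsup : L₁ ⊔ F₁ = ((L ⊔ F) ⊓ X₁).addSubgroupOf X₁ := by
      rw [hL₁, hF₁, ← AddSubgroup.inf_addSubgroupOf_right L, ← AddSubgroup.inf_addSubgroupOf_right F,
        ← AddSubgroup.addSubgroupOf_sup inf_le_right inf_le_right,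
        ← sup_inf_eq_inf_sup_inf_of_split X₁ X₂ hXinf sL sF]
    rw [hsup, hb₁, iInf_ker_restrict_eq, hannG₁]
    -- `((L ⊔ F) ⊓ X₁ ⊓ X₁)^⊥ ∩ Y₁ = (L ⊔ F)^⊥ ∩ Y₁ = (L' ⊔ G^⊥) ∩ Y₁ = (L' ∩ Y₁) ⊔ (G^⊥ ∩ Y₁)`
    rw [← AddSubgroup.inf_addSubgroupOf_right, inf_assoc, inf_idem,
      iInf_ker_inf_inf_eq_of_split bS X₁ X₂ Y₁ h21 sLF, hann,
      sup_inf_eq_inf_sup_inf_of_split Y₁ Y₂ hYinf sL' sAnn,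
      AddSubgroup.addSubgroupOf_sup inf_le_right inf_le_right, AddSubgroup.inf_addSubgroupOf_right,
      AddSubgroup.inf_addSubgroupOf_right, hL'₁]
  have key := relIndex_mul_relIndex_eq_of_iInf_ker_sup b₁ hX₁ hY₁ hl₁ hr₁ F₁ G₁ L₁ L'₁ hFG₁ hann₁
  rw [hannG₁, hF₁, hL₁, hG₁, hL'₁, ← AddSubgroup.inf_addSubgroupOf_right L,
    ← AddSubgroup.inf_addSubgroupOf_right G, ← AddSubgroup.inf_addSubgroupOf_right L',
    AddSubgroup.relIndex_addSubgroupOf inf_le_right, AddSubgroup.relIndex_addSubgroupOf inf_le_right,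
    AddSubgroup.relIndex_addSubgroupOf inf_le_right] at key
  exact key

end SplitCounting

end Summit.BirchSwinnertonDyer.Rank1Residual.JET.GlobalDuality

end
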